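import Summits.CriticalPhenomena.PercolationContinuityZ3.Theorems.Transplant.FKThreeApexT3EnvelopeCertQ1B
import Summits.CriticalPhenomena.PercolationContinuityZ3.Theorems.Transplant.FKThreeApexT3EnvelopeCertQ2C
import Summits.CriticalPhenomena.PercolationContinuityZ3.Theorems.Transplant.FKThreeApexT3EnvelopeCertThirdB
import Summits.CriticalPhenomena.PercolationContinuityZ3.Theorems.Transplant.FKThreeApexNegCorrT3OfEnvelope
import HarnessLib

/-!
# The three-apex monoid: (A), type T3 and all pairs of the weighted `K_{1,1,1,n}` on the range `1/4 ≤ q ≤ 1`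

Support file (`--supports stmt-CriticalPhenomena-4575`), FK sub-lane `prim-bschramm-fk-3` (gen 16); builds on p205010 (kernel theorem, internal audit
signed; external expert review pending).  No named facts, no sorries; standard axioms.  Memo `bschramm/prim-bschramm-fk-3/T3-ENVELOPE.md` §5–§9.

Assembly of the four exact LP certificates for the envelope statement `(A)`: `[1/4, 11/40]` (`…CertQ1A/B`), `[11/40, 3/10]` (`…CertQ2A/B/C`),
`[3/10, 1/2]` (`…CertThirdA/B`), `[1/2, 1]` (`…CertHalf`) — **`envelopeA_of_ge_quarter`**; hence type T3 on the monoid (`InK.t3Form_nonneg_of_ge_quarter`)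
and, by `…NegCorrT3OfEnvelope`, at the measure level: the T3 pairs (`negCorrTri_T3_of_ge_quarter`) and EVERY pair of edges of the weighted `K_{1,1,1,n}`
(`negCorrTri_allPairs_of_ge_quarter`) are negatively correlated for all `q ∈ [1/4, 1]`.  Below `q = 1/4` the statement `EnvelopeA q` is open (memo §8–§9).
[cite: Grimmett2006, §3.9 eq. (3.94), Conj. (3.96) (pp. 63–66)] [cite: Wagner2006, Conj. 5.3 (p. 13)]
-/

noncomputable section

namespace Summit.CriticalPhenomena.PercolationContinuityZ3.Theorems

namespace FK

namespace ThreeApex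

/-- **(A) for `q ∈ [1/4, 1]`** (the four certificates glued). [folklore] -/
theorem envelopeA_of_ge_quarter {q : ℝ} (hq : 1 / 4 ≤ q) (hq1 : q ≤ 1) : EnvelopeA q := by
  by_cases h1 : q ≤ 11 / 40
  · exact envelopeA_of_mem_certQ1_ (by norm_num at hq h1 ⊢; linarith) (by norm_num at hq h1 ⊢; linarith)
  · by_cases h2 : q ≤ 3 / 10
    · exact envelopeA_of_mem_certQ2_ (by norm_num at h1 h2 ⊢; linarith) (by norm_num at h1 h2 ⊢; linarith)
    · exact envelopeA_of_ge_three_tenths (by norm_num at h1 h2 ⊢; linarith) hq1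

/-- **Type T3 for `q ∈ [1/4, 1]`**: the T3 Rayleigh form is non-negative for all leaf probabilities and every rest in the monoid. [folklore] -/
theorem InK.t3Form_nonneg_of_ge_quarter {q : ℝ} (hq : 1 / 4 ≤ q) (hq1 : q ≤ 1) {b₁ c₁ a₂ c₂ : ℝ}
    (hb0 : 0 ≤ b₁) (hb1 : b₁ ≤ 1) (hc0 : 0 ≤ c₁) (hc1 : c₁ ≤ 1) (ha0 : 0 ≤ a₂) (ha1 : a₂ ≤ 1) (hd0 : 0 ≤ c₂) (hd1 : c₂ ≤ 1)
    {R : V5} (hR : InK q R) : 0 ≤ t3Form q b₁ c₁ a₂ c₂ R :=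
  hR.t3Form_nonneg_of_envelopeA (by linarith) hq1 (envelopeA_of_ge_quarter hq hq1) hb0 hb1 hc0 hc1 ha0 ha1 hd0 hd1

/-! ### Measure level -/

section Setting

open Literature.Probability.LatticeModels Literature.Probability.Percolation
open scoped Classical

variable {V : Type*} [Fintype V]
variable {a b c : V} {v : ℕ → V} {n : ℕ}
variable (hab : a ≠ b) (hac : a ≠ c) (hbc : b ≠ c) (hinj : ∀ j k, j < n → k < n → v j = v k → j = k)
  (hva : ∀ j, j < n → v j ≠ a) (hvb : ∀ j, j < n → v j ≠ b) (hvc : ∀ j, j < n → v j ≠ c)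
include hab hac hbc hinj hva hvb hvc

/-- **T3 in `K_{1,1,1,n}` for `q ∈ [1/4, 1]`**: for distinct apices `x ≠ y` and distinct leaves `j₁ ≠ j₂` the leaf edges `s(x, v j₁)`, `s(y, v j₂)` are
negatively correlated under `φ_{w,q}` for arbitrary weights on the full pattern. (transcription of bschramm/prim-bschramm-fk-3/T3-ENVELOPE.md §6–§9) -/
theorem negCorrTri_T3_of_ge_quarter {q : ℝ} (hq : 1 / 4 ≤ q) (hq1 : q ≤ 1) (hcard : Fintype.card V = n + 3) (w : Sym2 V → unitInterval)
    (hsupp : ∀ e, e ∉ fullPairs a b c v n → w e = 0) {j₁ j₂ : ℕ} (hj₁ : j₁ < n) (hj₂ : j₂ < n) (hne : j₁ ≠ j₂) {x y : V}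
    (hx : x = a ∨ x = b ∨ x = c) (hy : y = a ∨ y = b ∨ y = c) (hxy : x ≠ y) :
    (rcMeasureW w q ∅).real ({ω : BondConfig V | s(x, v j₁) ∈ ω} ∩ {ω | s(y, v j₂) ∈ ω}) ≤
      (rcMeasureW w q ∅).real {ω : BondConfig V | s(x, v j₁) ∈ ω} * (rcMeasureW w q ∅).real {ω : BondConfig V | s(y, v j₂) ∈ ω} :=
  negCorrTri_T3_of_envelopeA hab hac hbc hinj hva hvb hvc (by linarith) hq1 (envelopeA_of_ge_quarter hq hq1) hcard w hsupp hj₁ hj₂ hne hx hy hxy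

/-- **Every pair of edges of the weighted `K_{1,1,1,n}` is negatively correlated for `q ∈ [1/4, 1]`.**
(transcription of bschramm/prim-bschramm-fk-3/T3-ENVELOPE.md §6–§9) -/
theorem negCorrTri_allPairs_of_ge_quarter {q : ℝ} (hq : 1 / 4 ≤ q) (hq1 : q ≤ 1) (hcard : Fintype.card V = n + 3)
    (w : Sym2 V → unitInterval) (hsupp : ∀ e, e ∉ fullPairs a b c v n → w e = 0) {e f : Sym2 V} (he : e ∈ fullPairs a b c v n)
    (hf : f ∈ fullPairs a b c v n) (hfe : f ≠ e) :
    (rcMeasureW w q ∅).real ({ω : BondConfig V | e ∈ ω} ∩ {ω | f ∈ ω}) ≤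
      (rcMeasureW w q ∅).real {ω : BondConfig V | e ∈ ω} * (rcMeasureW w q ∅).real {ω : BondConfig V | f ∈ ω} :=
  negCorrTri_allPairs_of_envelopeA hab hac hbc hinj hva hvb hvc (by linarith) hq1 (envelopeA_of_ge_quarter hq hq1) hcard w hsupp he hf hfe

end Setting

end ThreeApex

end FK

end Summit.CriticalPhenomena.PercolationContinuityZ3.Theorems
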